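import Summits.Parity.GeneralizedHardyLittlewood.Theorems.LeeYangFibresFibreHyperbolicityAlongDefs
import Summits.Parity.GeneralizedHardyLittlewood.Theorems.LeeYangFibresAbsoluteUpgradeSinglesDecay
import Summits.Parity.GeneralizedHardyLittlewood.Theorems.LeeYangFibresAbsoluteUpgradeQuantClip
import Summits.Parity.GeneralizedHardyLittlewood.Theorems.LeeYangFibresAbsoluteUpgradeQuantClipNumerics
import Summits.Parity.GeneralizedHardyLittlewood.Theorems.LeeYangFibresFibreHyperbolicityAlongSiftedSinglesAlongScale
import Summits.Parity.GeneralizedHardyLittlewood.Theorems.LeeYangFibresFibreHyperbolicityAlongSiftedSinglesAlongSieve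
import HarnessLib

/-!
# Route `LeeYangFibres`, crux `FibreHyperbolicityAlong` (stmt-Parity-18103), line
# `sifted-chowla-distillation`: the registered stub `stub_siftedSinglesAlong : SiftedSinglesAlong`

`SiftedSinglesAlong` (vocabulary `Theorems/LeeYangFibresFibreHyperbolicityAlongDefs.lean`): for `t ≥ 1`
forms of size `≤ L` and EVERY `C`, for `N ≥ N₀(t, L, C)`, uniformly over non-degenerate `Ψ`, convex
`K ⊆ [-N, N]` and `i`,
`|∑_{n ∈ roughTuples Ψ K N U} λ(ψ_i(n))| ≤ e^{−C U} N U^t/(log N)^t` along the schedule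
`U = U(N) = slowDegree N = max 4 ⌊√(log log N)/2⌋`.

Proof.  At the scale `N` (past all thresholds) we run the one-scale engine of the sibling stub
`stub_singlesDecay` (line `nlc-cells-absolute-clip`) with the SHARP Fundamental Lemma:
* a local obstruction of `F_Ψ = ∏ ψ_k` below `N^{1/U}` empties the rough tuples; otherwise the root
  density `ω_{F_Ψ}(m)/m` (`ω ≤ L + t`) satisfies Iwaniec's `Ω(L+t, Λ)` (helper file 1,
  `hasIwaniecDimension_rootDensity_of_le`);
* the rough tuples are the rough points of the integer interval of positive lattice points of `K`
  (`exists_interval`, `roughTuples_sum_eq`), sifted at `z = ⌊N^{1/U}⌋ + 1` to level `D = N^{1/8}`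
  (`s = log D/log z ≥ U/16`) with the two sign classes of `λ(ψ_i)` cancelling (`singles_largeU_eps`, helper
  file 2) and the sieve error `ε = e^{−Ms} + C₁ (log D)^{−1/3}` of the sharp Fundamental Lemma
  (`fundamental_lemma_superexp`, helper file 1, from Iwaniec's Rosser sieve; `M = 16(C+4)`;
  `exists_hasIwaniecDimension_rootDensity` for the dimension condition);
* the Liouville class sums are `≪ N/(log N)^{t+3}` (Bombieri–Vinogradov for `λ`, tree `rem_le`);
* along the schedule `e^{4U²} ≤ log N` (`quantClip_schedule`), so `ε ≤ (1 + C₁) e^{−(C+4)U}`, the mass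
  `β_∞ ∏β_p ≤ C_m N (log log N)^{t-1} ≤ C_m N (2U+2)^{2t-2}` (`quantClip_massGrowth`) costs a power of `U`,
  and every junk term `N/(log N)^{t+1}` is `≤ ½ e^{−CU} N U^t/(log N)^t`.
Unconditional; standard axioms.

References: H. Iwaniec, *Rosser's sieve*, Acta Arith. 36 (1980), Thm 1 [IwaniecActaArith1980];
H. Halberstam, H.-E. Richert, *Sieve Methods* (1974), Thm 2.5 [HalberstamRichert1974];
H. Iwaniec, E. Kowalski, *Analytic Number Theory* (2004), Thm 17.4 [IwaniecKowalski2004];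
B. Green, T. Tao, Ann. of Math. 171 (2010), §1 [GreenTao2010].
-/

noncomputable section

open Finset Polynomial ArithmeticFunction Filter

namespace Summit.Parity.GeneralizedHardyLittlewood.Cruxes.FibreHyperbolicityAlong.SiftedChowlaDistillation

open scoped BigOperators Classical
open Literature.NumberTheory.Sieve
open Summit.Parity.GeneralizedHardyLittlewood.Theses.LeeYangFibres (CellParityLawSaving)
open Summit.Parity.GeneralizedHardyLittlewood.Cruxes.AbsoluteUpgrade.DipMarginRateExchange (slowDegree
  quantClip_schedule quantClip_massGrowth)
open Summit.Parity.GeneralizedHardyLittlewood.Cruxes.ModelHyperbolicity.WindowChainTransport (cellDensity)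
open Summit.Parity.GeneralizedHardyLittlewood.Cruxes.FibreHyperbolicity.ModelTransfer (jointCell)
open Summit.Parity.GeneralizedHardyLittlewood.Cruxes.AbsoluteUpgrade.NlcCellsAbsoluteClip (roughTuples)
open Summit.Parity.GeneralizedHardyLittlewood.Theorems.ModelHyperbolicity.Negative (cell)
open Summit.Parity.GeneralizedHardyLittlewood.Theorems.AbsoluteUpgrade

/-! ### Numerics along the schedule (`e^{4U²} ≤ log N`) -/

/-- The roughness threshold: `B₀ ≤ N^{1/U}` once `log B₀ ≤ U` and `e^{4U²} ≤ log N`. [folklore] -/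
theorem le_rpow_inv_of_schedule {B₀ U : ℝ} {N : ℕ} (hB₀ : 0 < B₀) (hU : 1 ≤ U)
    (hlB : Real.log B₀ ≤ U) (hN : (0 : ℝ) < N) (hsched : Real.exp (4 * U ^ 2) ≤ Real.log N) :
    B₀ ≤ (N : ℝ) ^ (1 / U) := by
  have h1 : U * Real.log B₀ ≤ Real.log N := by
    calc U * Real.log B₀ ≤ U * U := mul_le_mul_of_nonneg_left hlB (by linarith)
      _ ≤ 4 * U ^ 2 + 1 := by nlinarith
      _ ≤ Real.exp (4 * U ^ 2) := Real.add_one_le_exp _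
      _ ≤ Real.log N := hsched
  rw [Real.rpow_def_of_pos hN]
  calc B₀ = Real.exp (Real.log B₀) := (Real.exp_log hB₀).symm
    _ ≤ Real.exp (Real.log N * (1 / U)) := by
        rw [Real.exp_le_exp, mul_one_div, le_div_iff₀ (by linarith)]
        linarith

/-- `8 ≤ e³`. [folklore] -/
theorem eight_le_exp_three : (8 : ℝ) ≤ Real.exp 3 := by
  have h : Real.exp 3 = Real.exp 1 ^ 3 := by rw [← Real.exp_nat_mul]; norm_num
  have h1 := Real.exp_one_gt_d9
  have h2 : (2.7182818283 : ℝ) ^ 3 ≤ Real.exp 1 ^ 3 := pow_le_pow_left₀ (by norm_num) h1.le 3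
  rw [h]
  exact le_trans (by norm_num) h2

/-- The level term: `(log N^{1/8})^{-1/3} ≤ e^{-(C'+4)U}` once `0 ≤ C'`, `4 ≤ U`, `C' + 4 ≤ U` and
`e^{4U²} ≤ log N` (`log N/8 ≥ e^{3(C'+4)U}`). [folklore] -/
theorem rpow_log_level_le {C' U : ℝ} {N : ℕ} (hC' : 0 ≤ C') (hU4 : 4 ≤ U) (hCU : C' + 4 ≤ U)
    (hN : (0 : ℝ) < N) (hsched : Real.exp (4 * U ^ 2) ≤ Real.log N) :
    Real.log ((N : ℝ) ^ ((1 : ℝ) / 8)) ^ (-(1 / 3 : ℝ)) ≤ Real.exp (-((C' + 4) * U)) := by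
  have hlogD : Real.log ((N : ℝ) ^ ((1 : ℝ) / 8)) = Real.log N / 8 := by
    rw [Real.log_rpow hN]; ring
  have h1 : Real.exp (3 * ((C' + 4) * U)) ≤ Real.log N / 8 := by
    rw [le_div_iff₀ (by norm_num : (0 : ℝ) < 8)]
    have hq : 3 + 3 * ((C' + 4) * U) ≤ 4 * U ^ 2 := by
      nlinarith [mul_le_mul_of_nonneg_left hCU (by linarith : (0 : ℝ) ≤ 4 * U)]
    calc Real.exp (3 * ((C' + 4) * U)) * 8 ≤ Real.exp (3 * ((C' + 4) * U)) * Real.exp 3 :=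
          mul_le_mul_of_nonneg_left eight_le_exp_three (Real.exp_pos _).le
      _ = Real.exp (3 + 3 * ((C' + 4) * U)) := by rw [← Real.exp_add]; ring_nf
      _ ≤ Real.exp (4 * U ^ 2) := Real.exp_le_exp.mpr hq
      _ ≤ Real.log N := hsched
  rw [hlogD]
  calc (Real.log N / 8) ^ (-(1 / 3 : ℝ)) ≤ (Real.exp (3 * ((C' + 4) * U))) ^ (-(1 / 3 : ℝ)) :=
        Real.rpow_le_rpow_of_nonpos (Real.exp_pos _) h1 (by norm_num)
    _ = Real.exp (-((C' + 4) * U)) := by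
        rw [← Real.exp_mul]; congr 1; ring

/-- The sieve error is at most `1`: `(1 + C₁) e^{-(C'+4)U} ≤ 1` once `1 + C₁ ≤ U`. [folklore] -/
theorem eta_le_one {C' C₁ U : ℝ} (hC' : 0 ≤ C') (hC₁ : 0 ≤ C₁) (hU : 1 + C₁ ≤ U) :
    (1 + C₁) * Real.exp (-((C' + 4) * U)) ≤ 1 := by
  have hU0 : 0 ≤ U := by linarith
  have h1 : 1 + C₁ ≤ Real.exp ((C' + 4) * U) :=
    calc 1 + C₁ ≤ U := hU
      _ ≤ U + 1 := by linarith
      _ ≤ Real.exp U := Real.add_one_le_exp U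
      _ ≤ Real.exp ((C' + 4) * U) := Real.exp_le_exp.mpr (by nlinarith)
  rw [Real.exp_neg, ← div_eq_mul_inv, div_le_one (Real.exp_pos _)]
  exact h1

/-- The main-term numerics: `4 (1 + C₁) e^{-(C'+4)U} C_m (2U+2)^k ≤ e^{-C'U}` once
`4(1+C₁) C_m k! e² ≤ U` (`(2U+2)^k ≤ k! e^{2U+2}`). [folklore] -/
theorem main_coeff_le {C' C₁ Cm U : ℝ} {k : ℕ} (hC₁ : 0 ≤ C₁) (hCm : 0 ≤ Cm) (hU : 0 ≤ U)
    (hQ : 4 * (1 + C₁) * Cm * (k.factorial : ℝ) * Real.exp 2 ≤ U) :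
    4 * ((1 + C₁) * Real.exp (-((C' + 4) * U))) * Cm * (2 * U + 2) ^ k ≤ Real.exp (-(C' * U)) := by
  have h1 : (2 * U + 2) ^ k ≤ (k.factorial : ℝ) * Real.exp (2 * U + 2) := by
    have := Real.pow_div_factorial_le_exp (2 * U + 2) (by linarith) k
    rw [div_le_iff₀ (by positivity)] at this
    linarith
  have h2 : 4 * (1 + C₁) * Cm * (k.factorial : ℝ) * Real.exp 2 ≤ Real.exp (2 * U) :=
    hQ.trans (by linarith [Real.add_one_le_exp U, Real.exp_le_exp.mpr (by linarith : U ≤ 2 * U)])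
  have h0 : 0 ≤ 4 * ((1 + C₁) * Real.exp (-((C' + 4) * U))) * Cm := by positivity
  calc 4 * ((1 + C₁) * Real.exp (-((C' + 4) * U))) * Cm * (2 * U + 2) ^ k
      ≤ 4 * ((1 + C₁) * Real.exp (-((C' + 4) * U))) * Cm * ((k.factorial : ℝ) * Real.exp (2 * U + 2)) :=
        mul_le_mul_of_nonneg_left h1 h0
    _ = (4 * (1 + C₁) * Cm * (k.factorial : ℝ) * Real.exp 2) *
          (Real.exp (2 * U) * Real.exp (-((C' + 4) * U))) := by
        rw [show (2 * U + 2 : ℝ) = 2 * U + 2 from rfl, Real.exp_add]; ring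
    _ ≤ Real.exp (2 * U) * (Real.exp (2 * U) * Real.exp (-((C' + 4) * U))) :=
        mul_le_mul_of_nonneg_right h2 (by positivity)
    _ = Real.exp (-(C' * U)) := by
        rw [← Real.exp_add, ← Real.exp_add]; congr 1; ring

/-- The junk numerics: `2 e^{C'U} ≤ log N` once `0 ≤ C'`, `C' + 1 ≤ U` and `e^{4U²} ≤ log N`. [folklore] -/
theorem two_mul_exp_le_log {C' U : ℝ} {N : ℕ} (hC' : 0 ≤ C') (hCU : C' + 1 ≤ U)
    (hsched : Real.exp (4 * U ^ 2) ≤ Real.log N) : 2 * Real.exp (C' * U) ≤ Real.log N := by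
  have hq : C' * U + 1 ≤ 4 * U ^ 2 := by
    nlinarith [mul_le_mul_of_nonneg_left hCU (by linarith : (0 : ℝ) ≤ U)]
  have h2e : (2 : ℝ) ≤ Real.exp 1 := by linarith [Real.add_one_le_exp (1 : ℝ)]
  calc 2 * Real.exp (C' * U) ≤ Real.exp 1 * Real.exp (C' * U) :=
        mul_le_mul_of_nonneg_right h2e (Real.exp_pos _).le
    _ = Real.exp (C' * U + 1) := by rw [← Real.exp_add]; ring_nf
    _ ≤ Real.exp (4 * U ^ 2) := Real.exp_le_exp.mpr hq
    _ ≤ Real.log N := hsched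

/-- Absorbing the junk: `N/(log N)^{t+1} ≤ ½ · e^{-C'U} N U^t/(log N)^t` once `2 e^{C'U} ≤ log N` and
`U ≥ 1`. [folklore] -/
theorem junk_le_half {N Lg U C' : ℝ} {t : ℕ} (hN : 0 ≤ N) (hLg : 0 < Lg) (hU1 : 1 ≤ U)
    (h : 2 * Real.exp (C' * U) ≤ Lg) :
    N / Lg ^ (t + 1) ≤ (1 / 2) * (Real.exp (-(C' * U)) * N * U ^ t / Lg ^ t) := by
  have hprod : 2 ≤ Real.exp (-(C' * U)) * Lg := by
    have h1 := mul_le_mul_of_nonneg_left h (Real.exp_pos (-(C' * U))).le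
    have e : Real.exp (-(C' * U)) * (2 * Real.exp (C' * U)) = 2 := by
      rw [mul_left_comm, ← Real.exp_add, neg_add_cancel, Real.exp_zero, mul_one]
    linarith
  have h1 : 1 / Lg ≤ Real.exp (-(C' * U)) / 2 := by
    rw [div_le_div_iff₀ hLg two_pos]; linarith
  have hUt : (1 : ℝ) ≤ U ^ t := one_le_pow₀ hU1
  calc N / Lg ^ (t + 1) = N / Lg ^ t * (1 / Lg) := by rw [pow_succ]; field_simp
    _ ≤ N / Lg ^ t * (Real.exp (-(C' * U)) / 2) := mul_le_mul_of_nonneg_left h1 (by positivity)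
    _ ≤ N / Lg ^ t * (Real.exp (-(C' * U)) / 2) * U ^ t := le_mul_of_one_le_right (by positivity) hUt
    _ = (1 / 2) * (Real.exp (-(C' * U)) * N * U ^ t / Lg ^ t) := by ring

/-- A natural ceiling threshold in real form: `x ≤ ⌈x⌉₊ ≤ U`. [folklore] -/
theorem le_of_ceil_le {x : ℝ} {n U : ℕ} (hn : ⌈x⌉₊ ≤ n) (hU : n ≤ U) : x ≤ (U : ℝ) :=
  (Nat.le_ceil x).trans (by exact_mod_cast hn.trans hU)

/-! ### The stub -/

set_option maxHeartbeats 1600000 in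
/-- **`SiftedSinglesAlong`** (registered stub `stub_siftedSinglesAlong` of the line
`sifted-chowla-distillation`, crux `FibreHyperbolicityAlong`, stmt-Parity-18103): for `t ≥ 1` forms of size
`≤ L` and every `C`, for `N ≥ N₀`, uniformly over non-degenerate `Ψ`, convex `K ⊆ [-N, N]` and `i`,
`|∑_{n ∈ roughTuples Ψ K N U} λ(ψ_i(n))| ≤ e^{−CU} N U^t/(log N)^t` along `U = slowDegree N`.  See the module
docstring: the one-scale engine of `stub_singlesDecay` run with the sharp Fundamental Lemma (Iwaniec's Rosser
sieve: relative error `e^{−Ms} + C₁(log D)^{−1/3}`, `s ≥ U/16`, `M = 16(C+4)`) along the schedule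
`e^{4U²} ≤ log N`.  Unconditional. [cite: IwaniecActaArith1980, Thm 1 (1.4)–(1.6)] -/
theorem stub_siftedSinglesAlong : SiftedSinglesAlong := by
  intro t L ht C
  -- WLOG `C ≥ 0`
  set C' : ℝ := max C 0 with hC'def
  have hC'0 : 0 ≤ C' := le_max_right _ _
  have hCC' : C ≤ C' := le_max_left _ _
  -- constants depending on `t, L, C` only
  have hB1 : 1 ≤ L + t := by omega
  have hκ : (1 : ℝ) / 2 < ((L + t : ℕ) : ℝ) := by linarith [(by exact_mod_cast hB1 : (1 : ℝ) ≤ ((L + t : ℕ) : ℝ))]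
  obtain ⟨Lreg, hLreg⟩ := exists_hasIwaniecDimension_rootDensity hB1
  obtain ⟨s₀, C₁, hC₁0, hFLs⟩ := fundamental_lemma_superexp hκ Lreg (16 * (C' + 4))
  obtain ⟨Cr, x₀, hCr⟩ := classSums_le (L + t) t
  obtain ⟨Cm, hCm, N₃, hmass⟩ := quantClip_massGrowth t L ht
  -- the schedule threshold `U ≥ U₀`
  obtain ⟨N₁, hN₁⟩ := quantClip_schedule (17 + ⌈Real.log ((L : ℝ) + 4 * t ^ 2 + t + 2)⌉₊ + ⌈16 * s₀⌉₊ +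
    (⌈C'⌉₊ + 4) + ⌈1 + C₁⌉₊ + ⌈4 * (1 + C₁) * Cm * ((2 * (t - 1)).factorial : ℝ) * Real.exp 2⌉₊)
  -- thresholds in `N`
  have hev : ∀ᶠ N : ℕ in atTop, ((16 : ℝ) ≤ N ∧ 1 ≤ Real.log N) ∧
      (((N : ℝ) ^ ((1 : ℝ) / 17) + 1 ≤ (N : ℝ) ^ ((1 : ℝ) / 8)) ∧
      ((max (L : ℝ) 1 * (N : ℝ) ^ ((1 : ℝ) / 8) ≤ (2 * max (L : ℝ) 1 * N) ^ ((1 : ℝ) / 4)) ∧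
      ((x₀ ≤ (N : ℝ)) ∧
      (((t : ℝ) + 1) + 2 * L * max Cr 0 * N / Real.log N ^ (t + 3) ≤ (N : ℝ) / Real.log N ^ (t + 1))))) :=
    eventually_basic.and (eventually_level.and ((eventually_quarter (lt_max_of_lt_right one_pos)).and
      ((eventually_ge_real x₀).and (eventually_junk t _ _))))
  obtain ⟨N₂, hN₂⟩ := eventually_atTop.mp hev
  refine ⟨max (max N₁ N₂) N₃, fun N hN Ψ hΨ hL K hK hKN i => ?_⟩
  have hNN₁ : N₁ ≤ N := le_trans ((le_max_left _ _).trans (le_max_left _ _)) hN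
  have hNN₂ : N₂ ≤ N := le_trans ((le_max_right _ _).trans (le_max_left _ _)) hN
  have hNN₃ : N₃ ≤ N := le_trans (le_max_right _ _) hN
  obtain ⟨hU₀U, -, hsched, hloglog⟩ := hN₁ N hNN₁
  obtain ⟨⟨h16, hlog1⟩, hlevel, hquarter, hx₀, hjunk⟩ := hN₂ N hNN₂
  have hAS := hmass N hNN₃ Ψ hΨ hL K hKN
  generalize hUdef : slowDegree N = U at hU₀U hsched hloglog ⊢
  -- the thresholds on `U`, in real form
  have hU17 : 17 ≤ U := by omega
  have hU1 : 1 ≤ U := by omega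
  have hUr17 : (17 : ℝ) ≤ U := by exact_mod_cast hU17
  have hUr4 : (4 : ℝ) ≤ U := by linarith
  have hUr1 : (1 : ℝ) ≤ U := by linarith
  have hu0 : (0 : ℝ) < U := by linarith
  have hlB : Real.log ((L : ℝ) + 4 * t ^ 2 + t + 2) ≤ U := le_of_ceil_le le_rfl (by omega)
  have hs₀U : 16 * s₀ ≤ U := le_of_ceil_le le_rfl (by omega)
  have hC'U : C' + 4 ≤ U := by
    have h1 : C' ≤ ((⌈C'⌉₊ : ℕ) : ℝ) := Nat.le_ceil C'
    have h2 : ((⌈C'⌉₊ + 4 : ℕ) : ℝ) ≤ U := by exact_mod_cast (show ⌈C'⌉₊ + 4 ≤ U by omega)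
    push_cast at h2
    linarith
  have hC₁U : 1 + C₁ ≤ U := le_of_ceil_le le_rfl (by omega)
  have hQU : 4 * (1 + C₁) * Cm * ((2 * (t - 1)).factorial : ℝ) * Real.exp 2 ≤ U :=
    le_of_ceil_le le_rfl (by omega)
  -- basic positivity
  have hNpos : (0 : ℝ) < N := by linarith
  have hN1r : (1 : ℝ) ≤ N := by linarith
  have hlogpos : 0 < Real.log N := by linarith
  have haL : ∀ k, ((Ψ k).coeff 0).natAbs ≤ L := fun k => natAbs_coeff_le_of_affLinSize_le hL k 0
  have hAF0 : 0 ≤ archFactor Ψ K := archFactor_nonneg Ψ K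
  have hSP0 : 0 ≤ singularProduct Ψ :=
    ge_of_tendsto' (tendsto_singularProductPartial_holds 1 t Ψ hΨ)
      fun x => Finset.prod_nonneg fun p _ => localFactor_nonneg Ψ p
  have hRHS0 : 0 ≤ Real.exp (-(C * U)) * N * (U : ℝ) ^ t / Real.log N ^ t := by positivity
  -- the correlation is the real sum over the rough tuples
  have hcorr : ((siftedLiouvilleCorr t N U Ψ K {i} : ℤ) : ℝ) =
      ∑ n ∈ roughTuples Ψ K N U, (-1 : ℝ) ^ (cardFactors ((Ψ i).eval n).toNat) := by
    simp only [siftedLiouvilleCorr, Finset.prod_singleton, Int.cast_sum, Int.cast_pow, Int.cast_neg,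
      Int.cast_one]
  rw [hcorr]
  -- the rough threshold `y = N^{1/U} ≥ B₀ ≥ 2`
  have ht0 : (0 : ℝ) ≤ t := Nat.cast_nonneg t
  have hL0 : (0 : ℝ) ≤ L := Nat.cast_nonneg L
  have ht2 : (0 : ℝ) ≤ 4 * (t : ℝ) ^ 2 := by positivity
  have hB2 : (2 : ℝ) ≤ (L : ℝ) + 4 * t ^ 2 + t + 2 := by linarith
  have hyB : (L : ℝ) + 4 * t ^ 2 + t + 2 ≤ (N : ℝ) ^ ((1 : ℝ) / U) :=
    le_rpow_inv_of_schedule (by linarith) hUr1 hlB hNpos hsched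
  have hy2 : (2 : ℝ) ≤ (N : ℝ) ^ ((1 : ℝ) / U) := hB2.trans hyB
  have hhead : L ≤ ⌊(N : ℝ) ^ ((1 : ℝ) / U)⌋₊ ∧ 4 * t ^ 2 ≤ ⌊(N : ℝ) ^ ((1 : ℝ) / U)⌋₊ ∧
      1 ≤ ⌊(N : ℝ) ^ ((1 : ℝ) / U)⌋₊ := by
    refine ⟨Nat.le_floor ?_, Nat.le_floor ?_, Nat.le_floor ?_⟩
    · exact le_trans (by linarith) hyB
    · have : ((4 * t ^ 2 : ℕ) : ℝ) ≤ (L : ℝ) + 4 * t ^ 2 + t + 2 := by push_cast; linarith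
      exact this.trans hyB
    · have : ((1 : ℕ) : ℝ) ≤ (L : ℝ) + 4 * t ^ 2 + t + 2 := by push_cast; linarith
      exact this.trans hyB
  -- Case 1: a local obstruction below the threshold empties the rough tuples
  by_cases hobs : ∃ p : ℕ, p.Prime ∧ polyRootCountMod ![sysPoly Ψ] p = p
  · obtain ⟨p, hp, hρ⟩ := hobs
    have hpL : polyRootCountMod ![sysPoly Ψ] p ≤ L + t := rootCount_le_add hΨ haL hp
    rw [hρ] at hpL
    have hpy : (p : ℝ) ≤ (N : ℝ) ^ ((1 : ℝ) / U) :=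
      le_trans (by linarith [(by exact_mod_cast hpL : (p : ℝ) ≤ (L : ℝ) + t)]) hyB
    rw [roughTuples_eq_empty_of_obstructed Ψ hp hρ hpy hy2 K, Finset.sum_empty, abs_zero]
    exact hRHS0
  -- Case 2: no local obstruction; Iwaniec's dimension condition
  push Not at hobs
  have hlt : ∀ p : ℕ, p.Prime → polyRootCountMod ![sysPoly Ψ] p < p := fun p hp =>
    lt_of_le_of_ne (polyRootCountMod_le _ p) (hobs p hp)
  have hdimI : HasIwaniecDimension (rootDensity (sysPoly Ψ)) ((L + t : ℕ) : ℝ) Lreg :=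
    hLreg (sysPoly Ψ) (fun p hp => rootCount_le_add hΨ haL hp) hlt
  -- the interval of positive lattice points
  obtain ⟨m₁, m₂, hI, hcardI⟩ := exists_interval Ψ hK hKN
  have hIpos : ∀ m ∈ Icc m₁ m₂, ∀ k, 1 ≤ (Ψ k).eval (fun _ => m) := fun m hm => ((hI m).mp hm).2.2
  rw [roughTuples_sum_eq Ψ hy2 K i hI]
  rcases lt_or_ge m₂ m₁ with hm | hm
  · rw [Finset.Icc_eq_empty (not_le.mpr hm), Finset.filter_empty, Finset.sum_empty, abs_zero]
    exact hRHS0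
  -- the remainder (Bombieri–Vinogradov for `λ`)
  have hL1 : (1 : ℝ) ≤ L := one_le_of_affLinSize_le Ψ hΨ hL i
  rw [max_eq_left hL1] at hquarter
  have hRem := rem_le hCr hΨ hL h16 hlog1 hx₀ hquarter hm
    (fun m hm => ⟨((hI m).mp hm).1, ((hI m).mp hm).2.2⟩) i
  -- the sieve levels `z = ⌊N^{1/U}⌋ + 1 ≤ D = N^{1/8}`, `s = log D/log z ≥ U/16`
  have hzD : (((⌊(N : ℝ) ^ ((1 : ℝ) / U)⌋₊ + 1 : ℕ) : ℝ)) ≤ (N : ℝ) ^ ((1 : ℝ) / 8) := by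
    push_cast
    have h1 : (⌊(N : ℝ) ^ ((1 : ℝ) / U)⌋₊ : ℝ) ≤ (N : ℝ) ^ ((1 : ℝ) / U) := Nat.floor_le (by positivity)
    have h2 : (N : ℝ) ^ ((1 : ℝ) / U) ≤ (N : ℝ) ^ ((1 : ℝ) / 17) := by
      refine Real.rpow_le_rpow_of_exponent_le hN1r ?_
      rw [div_le_div_iff₀ hu0 (by norm_num)]
      linarith
    linarith
  have hy1 : (1 : ℝ) ≤ (N : ℝ) ^ ((1 : ℝ) / U) := by linarith
  have hyz : (N : ℝ) ^ ((1 : ℝ) / U) < (((⌊(N : ℝ) ^ ((1 : ℝ) / U)⌋₊ + 1 : ℕ) : ℝ)) := by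
    push_cast; exact Nat.lt_floor_add_one _
  have hz1 : (1 : ℝ) < (((⌊(N : ℝ) ^ ((1 : ℝ) / U)⌋₊ + 1 : ℕ) : ℝ)) := lt_of_le_of_lt hy1 hyz
  have hz2 : (2 : ℝ) ≤ (((⌊(N : ℝ) ^ ((1 : ℝ) / U)⌋₊ + 1 : ℕ) : ℝ)) := by exact_mod_cast Nat.succ_le_succ hhead.2.2
  have hzle : (((⌊(N : ℝ) ^ ((1 : ℝ) / U)⌋₊ + 1 : ℕ) : ℝ)) ≤ 2 * (N : ℝ) ^ ((1 : ℝ) / U) := by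
    push_cast
    linarith [Nat.floor_le (show (0 : ℝ) ≤ (N : ℝ) ^ ((1 : ℝ) / U) by positivity)]
  have hslow : (U : ℝ) / 16 ≤ Real.log ((N : ℝ) ^ ((1 : ℝ) / 8)) /
      Real.log (((⌊(N : ℝ) ^ ((1 : ℝ) / U)⌋₊ + 1 : ℕ) : ℝ)) := by
    have := exp_neg_le_exp_neg_div hU1 hy2 hz1 hzle
    rw [Real.exp_le_exp, neg_le_neg_iff] at this
    linarith
  have hs : s₀ ≤ Real.log ((N : ℝ) ^ ((1 : ℝ) / 8)) /
      Real.log (((⌊(N : ℝ) ^ ((1 : ℝ) / U)⌋₊ + 1 : ℕ) : ℝ)) := by linarith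
  have hD1 : (1 : ℝ) ≤ (N : ℝ) ^ ((1 : ℝ) / 8) := Real.one_le_rpow hN1r (by norm_num)
  have hlogD0 : 0 ≤ Real.log ((N : ℝ) ^ ((1 : ℝ) / 8)) := Real.log_nonneg hD1
  -- the sieve error `ε = e^{-Ms} + C₁ (log D)^{-1/3} ≤ η = (1 + C₁) e^{-(C'+4)U} ≤ 1`
  obtain ⟨ε, hε⟩ : ∃ ε : ℝ, ε = Real.exp (-(16 * (C' + 4) * (Real.log ((N : ℝ) ^ ((1 : ℝ) / 8)) /
      Real.log (((⌊(N : ℝ) ^ ((1 : ℝ) / U)⌋₊ + 1 : ℕ) : ℝ))))) +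
      C₁ * Real.log ((N : ℝ) ^ ((1 : ℝ) / 8)) ^ (-(1 / 3 : ℝ)) := ⟨_, rfl⟩
  have hεη : ε ≤ (1 + C₁) * Real.exp (-((C' + 4) * U)) := by
    have h1 : Real.exp (-(16 * (C' + 4) * (Real.log ((N : ℝ) ^ ((1 : ℝ) / 8)) /
        Real.log (((⌊(N : ℝ) ^ ((1 : ℝ) / U)⌋₊ + 1 : ℕ) : ℝ))))) ≤ Real.exp (-((C' + 4) * U)) := by
      rw [Real.exp_le_exp, neg_le_neg_iff]
      have := mul_le_mul_of_nonneg_left hslow (by positivity : (0 : ℝ) ≤ 16 * (C' + 4))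
      linarith
    have h2 := rpow_log_level_le hC'0 hUr4 hC'U hNpos hsched
    rw [hε]
    calc _ ≤ Real.exp (-((C' + 4) * U)) + C₁ * Real.exp (-((C' + 4) * U)) :=
          add_le_add h1 (mul_le_mul_of_nonneg_left h2 hC₁0)
      _ = (1 + C₁) * Real.exp (-((C' + 4) * U)) := by ring
  have hε0 : 0 ≤ ε := by
    rw [hε]
    have : 0 ≤ Real.log ((N : ℝ) ^ ((1 : ℝ) / 8)) ^ (-(1 / 3 : ℝ)) := Real.rpow_nonneg hlogD0 _
    positivity
  have hε1 : ε ≤ 1 := hεη.trans (eta_le_one hC'0 hC₁0 hC₁U)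
  -- the sharp Fundamental Lemma for the sequences of density `ω_{F_Ψ}(m)/m`
  have hFL' : ∀ A : SieveSequence, A.density = rootDensity (sysPoly Ψ) → ∀ x : ℝ, 0 ≤ A.size x →
      |A.sifted x (primesProdBelow (((⌊(N : ℝ) ^ ((1 : ℝ) / U)⌋₊ + 1 : ℕ) : ℝ))) -
          A.size x * A.densityProduct (primesProdBelow (((⌊(N : ℝ) ^ ((1 : ℝ) / U)⌋₊ + 1 : ℕ) : ℝ)))| ≤
        ε * A.size x * A.densityProduct (primesProdBelow (((⌊(N : ℝ) ^ ((1 : ℝ) / U)⌋₊ + 1 : ℕ) : ℝ))) +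
          ∑ d ∈ (primesProdBelow (((⌊(N : ℝ) ^ ((1 : ℝ) / U)⌋₊ + 1 : ℕ) : ℝ))).divisors.filter
            (fun d : ℕ => (d : ℝ) ≤ (N : ℝ) ^ ((1 : ℝ) / 8)), |A.remainder d x| := by
    intro A hA x hX
    have hdimA : HasIwaniecDimension A.density ((L + t : ℕ) : ℝ) Lreg := by rw [hA]; exact hdimI
    have h := hFLs A hdimA x _ _ hz2 hzD hX hs
    rw [hε]
    calc _ ≤ _ := h
      _ = _ := by ring
  -- the one-scale bound
  have key := singles_largeU_eps hΨ haL hIpos hAF0 hcardI hU1 hy2 hhead hε0 hε1 hFL' i hRem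
  refine key.trans ?_
  -- the main term: mass `≤ C_m N (2U+2)^{2t-2}`, `4 η C_m (2U+2)^{2t-2} ≤ e^{-C'U}`
  have hll0 : 0 ≤ Real.log (Real.log N) := Real.log_nonneg hlog1
  have hmassU : archFactor Ψ K * singularProduct Ψ ≤ Cm * N * (2 * (U : ℝ) + 2) ^ (2 * (t - 1)) := by
    have h2 : Real.log (Real.log N) ^ (t - 1) ≤ (2 * (U : ℝ) + 2) ^ (2 * (t - 1)) := by
      rw [pow_mul]; exact pow_le_pow_left₀ hll0 hloglog (t - 1)
    exact hAS.trans (mul_le_mul_of_nonneg_left h2 (by positivity))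
  have hmainc := main_coeff_le (C' := C') (k := 2 * (t - 1)) hC₁0 hCm.le hu0.le hQU
  have hT0 : 0 ≤ (N : ℝ) * (U : ℝ) ^ t / Real.log N ^ t := by positivity
  have hWt : 0 ≤ ((U : ℝ) / Real.log N) ^ t := by positivity
  have hmain : 2 * ε * (archFactor Ψ K * singularProduct Ψ) * ((U : ℝ) / Real.log N) ^ t ≤
      (1 / 2) * (Real.exp (-(C' * U)) * N * (U : ℝ) ^ t / Real.log N ^ t) := by
    have h1 : 2 * ε * (archFactor Ψ K * singularProduct Ψ) ≤
        2 * ((1 + C₁) * Real.exp (-((C' + 4) * U))) * (Cm * N * (2 * (U : ℝ) + 2) ^ (2 * (t - 1))) :=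
      mul_le_mul (mul_le_mul_of_nonneg_left hεη (by norm_num)) hmassU (mul_nonneg hAF0 hSP0)
        (by positivity)
    calc 2 * ε * (archFactor Ψ K * singularProduct Ψ) * ((U : ℝ) / Real.log N) ^ t
        ≤ 2 * ((1 + C₁) * Real.exp (-((C' + 4) * U))) * (Cm * N * (2 * (U : ℝ) + 2) ^ (2 * (t - 1))) *
            ((U : ℝ) / Real.log N) ^ t := mul_le_mul_of_nonneg_right h1 hWt
      _ = (1 / 2) * ((4 * ((1 + C₁) * Real.exp (-((C' + 4) * U))) * Cm * (2 * (U : ℝ) + 2) ^ (2 * (t - 1))) *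
            ((N : ℝ) * (U : ℝ) ^ t / Real.log N ^ t)) := by
          rw [div_pow]; ring
      _ ≤ (1 / 2) * (Real.exp (-(C' * U)) * ((N : ℝ) * (U : ℝ) ^ t / Real.log N ^ t)) := by
          have := mul_le_mul_of_nonneg_right hmainc hT0
          linarith
      _ = (1 / 2) * (Real.exp (-(C' * U)) * N * (U : ℝ) ^ t / Real.log N ^ t) := by ring
  -- the junk
  have hJ : (N : ℝ) / Real.log N ^ (t + 1) ≤
      (1 / 2) * (Real.exp (-(C' * U)) * N * (U : ℝ) ^ t / Real.log N ^ t) :=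
    junk_le_half hNpos.le hlogpos hUr1 (two_mul_exp_le_log hC'0 (by linarith) hsched)
  -- `e^{-C'U} ≤ e^{-CU}`
  have hfin : Real.exp (-(C' * U)) * N * (U : ℝ) ^ t / Real.log N ^ t ≤
      Real.exp (-(C * U)) * N * (U : ℝ) ^ t / Real.log N ^ t := by
    have he : Real.exp (-(C' * U)) ≤ Real.exp (-(C * U)) :=
      Real.exp_le_exp.mpr (neg_le_neg (mul_le_mul_of_nonneg_right hCC' hu0.le))
    have := mul_le_mul_of_nonneg_right he hT0
    calc Real.exp (-(C' * U)) * N * (U : ℝ) ^ t / Real.log N ^ t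
        = Real.exp (-(C' * U)) * ((N : ℝ) * (U : ℝ) ^ t / Real.log N ^ t) := by ring
      _ ≤ Real.exp (-(C * U)) * ((N : ℝ) * (U : ℝ) ^ t / Real.log N ^ t) := this
      _ = _ := by ring
  linarith

end Summit.Parity.GeneralizedHardyLittlewood.Cruxes.FibreHyperbolicityAlong.SiftedChowlaDistillation

end
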